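import Summits.BirchSwinnertonDyer.BirchSwinnertonDyer.Theorems.ResidualThetaTransportAtTwoSignedMuVanishingAtTwoPlusOldClassCongruence
import Mathlib.Algebra.Module.ZMod
import Mathlib.LinearAlgebra.Dual.Lemmas
import HarnessLib

/-!
# Route `ResidualThetaTransportAtTwo`, crux Kμ⁺ `SignedMuVanishingAtTwoPlus` (stmt-BirchSwinnertonDyer-20689), line
# `birth`, stub `stub_flatMuZeroAtTwo`: the (MO⁺) DICTIONARY, part 1 — uniqueness of the plus mod-2 eigencharacter
# (`hMO` of `…OldClassCongruence.flatAtTwo_of_multOne`) FROM «at most four mod-2 eigencharacters» AND «`Ω⁺_f/2` is not a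
# period of `f`»

Cell `bsd-wall`, width seat `bsd-wall-rtt-p4-w2` (g4). THEOREMS ONLY (no `def`, no named fact, no `sorry`); helper
`--supports` the crux; closes nothing. BSD is not proved by this; every hypothesis is a hypothesis.

## What is proved
Write `V(f)` for the set of maps `χ : Γ₀(N) → ZMod 2` that are additive, factor through the period functional
`γ ↦ {∞, γ∞}` and are Hecke eigencharacters with the eigenvalues `A p = a_p(f) mod 2` at ALL primes `p` (the three
"structural" clauses of the hypothesis `hMO` of `…OldClassCongruence.exists_odd_of_multOne` / `flatAtTwo_of_multOne`), and
call `χ` EVEN when `χ γ' = χ γ` whenever `γ' = εγε` (same `(0,0)` entry, opposite `(1,0)` entry). The hypothesis (MO⁺) = `hMO`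
says: two non-zero even members of `V(f)` coincide. Here (MO⁺) is DERIVED from two inputs:
* (I)  `hfour` — every finite set of members of `V(f)` has at most `4` elements («`dim_{𝔽₂} V(f) ≤ 2`»). This is the
  CHARACTER (cosocle) count that mod-2 multiplicity one `dim J₀(N)[𝔪_f] = 2` (the tree's named fact
  `buzzard2000_multiplicityOne_gamma0`, Buzzard 2000 Prop. 2.4) yields through a Hecke-self-adjoint perfect pairing on
  `H₁(X₀(N); ℤ)`; that passage is NOT in this file (parts 2–3 of the dictionary).
* (II) `hrh` — `Ω⁺_f/2 ∉ Λ_f`: half the real period is not a period, i.e. `Λ_f ∩ ℝ = ℤΩ⁺_f` (the period lattice is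
  RHOMBIC, `E_f(ℝ)` connected; for the habitat this is `Δ_W < 0` read on the optimal curve). It REPLACES the Galois-side input
  «complex conjugation acts on `J₀(N)[𝔪] ≅ W[2]` as a transposition» of the crux workfile `CuspSpanIhara.md` §3.6 (d): no
  Galois action on `J₀(N)` is needed.
Mechanism (`eq_of_card_le_four_of_exists_not_even`, abstract): `V(f)` is an `𝔽₂`-vector space and the even members form a
subspace; two distinct non-zero even members `χ₁, χ₂` give four even members `0, χ₁, χ₂, χ₁ + χ₂`, and (II) supplies a
NON-even member (`exists_eigenChar_not_even_of_half_plusPeriod_not_mem`: a character `φ` of `Λ_f/2Λ_f` with `φ(Ω⁺_f) ≠ 0`,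
composed with `γ ↦ {∞,γ∞}_f`; it is in `V(f)` because `T_p f = a_p f`, and `φ({∞,εγ₀ε∞}) − φ({∞,γ₀∞}) = φ(2 re{∞,γ₀∞}) =
φ(Ω⁺_f) ≠ 0` at a `γ₀` with `re{∞,γ₀∞} = Ω⁺_f/2`) — five members, contradicting (I). Conversely (`half_plusPeriod_not_mem_of_multOnePlus`)
(MO⁺) forces (II) whenever `V(f)` contains the characters of `Λ_f/2Λ_f`, so (II) is the exact complex-conjugation content of (MO⁺).
The assembly «(I) ∧ (II) ⟹ `hMO`» and `flatAtTwo_of_multOne` with `hMO` so replaced are the sequel `…MultOneFlat`.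

References: K. Buzzard, Math. Res. Lett. 7 (2000) Prop. 2.4 [Buzzard2000]; J. E. Cremona, *Algorithms for modular elliptic
curves* (1997) §2.8 (period lattice types, `Ω⁺ = Ω₀ · #π₀(E(ℝ))`) [CremonaAlgorithms1997]; B. Mazur, J. Tate, J. Teitelbaum,
Invent. Math. 84 (1986) §I.8 [MazurTateTeitelbaum1986Invent]; Ju. I. Manin (1972) §1.6 [Manin1972].
-/

set_option autoImplicit false
set_option linter.dupNamespace false

noncomputable section

open scoped Classical MatrixGroups ModularForm

open CongruenceSubgroup WeierstrassCurve Literature.NumberTheory.EllipticCurves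
  Literature.NumberTheory.EllipticCurves.ModularForms Literature.NumberTheory.EllipticCurves.Rank1Residual
  Literature.NumberTheory.IwasawaTheory Summit.BirchSwinnertonDyer.Rank1Residual.Supersingular
  Summit.BirchSwinnertonDyer.BirchSwinnertonDyer.Theses.ResidualThetaTransportAtTwo

namespace Summit.BirchSwinnertonDyer.BirchSwinnertonDyer.Theorems.SignedMuAtTwo

namespace MultOneDictionary

/-! ## §0. Two pieces of linear algebra over `𝔽₂` -/

section Abstract

/-- **Characters of `G/2G` separate points**: if `w` is not a double in the abelian group `G`, some additive map
`G → ZMod 2` does not vanish at `w` (the quotient `G/2G` is an `𝔽₂`-vector space, whose linear functionals separate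
points). [folklore] -/
theorem exists_addMonoidHom_zmod_two_apply_ne_zero {G : Type*} [AddCommGroup G] {w : G}
    (hw : ¬ ∃ y : G, 2 • y = w) : ∃ φ : G →+ ZMod 2, φ w ≠ 0 := by
  let D : G →+ G := nsmulAddMonoidHom 2
  let H : AddSubgroup G := D.range
  have hH : ∀ x : G, 2 • x ∈ H := fun x ↦ ⟨x, rfl⟩
  letI : Module (ZMod 2) (G ⧸ H) := QuotientAddGroup.zmodModule hH
  have hw' : (QuotientAddGroup.mk w : G ⧸ H) ≠ 0 := by
    intro h
    rw [QuotientAddGroup.eq_zero_iff] at h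
    obtain ⟨y, hy⟩ := h
    exact hw ⟨y, hy⟩
  obtain ⟨ψ, hψ⟩ := Module.Projective.exists_dual_ne_zero (ZMod 2) hw'
  exact ⟨ψ.toAddMonoidHom.comp (QuotientAddGroup.mk' H), by simpa using hψ⟩

/-- **At most four, one of them odd ⟹ the non-zero even one is unique.** Let `P` («eigencharacter») and `E` («even») be
properties of maps `G → ZMod 2`, both containing `0` and stable under addition. If every finite set of `P`-maps has at most
`4` elements and some `P`-map is not `E`, then any two NON-ZERO `P ∧ E`-maps are equal: otherwise
`0, χ₁, χ₂, χ₁ + χ₂` are four distinct `P ∧ E`-maps and the odd one is a fifth `P`-map. [folklore] -/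
theorem eq_of_card_le_four_of_exists_not_even {G : Type*} (P E : (G → ZMod 2) → Prop)
    (hP0 : P 0) (hPadd : ∀ χ χ', P χ → P χ' → P (χ + χ')) (hE0 : E 0) (hEadd : ∀ χ χ', E χ → E χ' → E (χ + χ'))
    (hfour : ∀ s : Finset (G → ZMod 2), (∀ χ ∈ s, P χ) → s.card ≤ 4) (hex : ∃ χ₀, P χ₀ ∧ ¬ E χ₀)
    {χ₁ χ₂ : G → ZMod 2} (h₁ : P χ₁) (e₁ : E χ₁) (h₂ : P χ₂) (e₂ : E χ₂) (n₁ : χ₁ ≠ 0) (n₂ : χ₂ ≠ 0) :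
    χ₁ = χ₂ := by
  classical
  by_contra h12
  obtain ⟨χ₀, h₀, e₀⟩ := hex
  have hneg : ∀ χ : G → ZMod 2, -χ = χ := fun χ ↦ by
    funext g; exact ZModModule.neg_eq_self _
  -- the five maps are pairwise distinct
  have h3 : χ₁ + χ₂ ≠ 0 := fun h ↦ h12 (by rw [← hneg χ₂]; exact eq_neg_of_add_eq_zero_left h)
  have h31 : χ₁ + χ₂ ≠ χ₁ := fun h ↦ n₂ (by simpa using h)
  have h32 : χ₁ + χ₂ ≠ χ₂ := fun h ↦ n₁ (by simpa using h)
  have h0E : ∀ χ, E χ → χ₀ ≠ χ := fun χ hχ h ↦ e₀ (h ▸ hχ)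
  let s : Finset (G → ZMod 2) := {χ₀, χ₁ + χ₂, χ₂, χ₁, 0}
  have hsP : ∀ χ ∈ s, P χ := by
    intro χ hχ
    simp only [s, Finset.mem_insert, Finset.mem_singleton] at hχ
    rcases hχ with rfl | rfl | rfl | rfl | rfl
    exacts [h₀, hPadd _ _ h₁ h₂, h₂, h₁, hP0]
  have hcard : s.card = 5 := by
    simp only [s]
    rw [Finset.card_insert_of_notMem, Finset.card_insert_of_notMem, Finset.card_insert_of_notMem,
      Finset.card_insert_of_notMem, Finset.card_singleton]
    · simpa using n₁
    · simp only [Finset.mem_insert, Finset.mem_singleton, not_or]; exact ⟨Ne.symm h12, n₂⟩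
    · simp only [Finset.mem_insert, Finset.mem_singleton, not_or]; exact ⟨h32, h31, h3⟩
    · simp only [Finset.mem_insert, Finset.mem_singleton, not_or]
      exact ⟨h0E _ (hEadd _ _ e₁ e₂), h0E _ e₂, h0E _ e₁, h0E _ hE0⟩
  have := hfour s hsP
  omega

end Abstract

/-! ## §1. The odd eigencharacter from «`Ω⁺_f/2` is not a period» -/

section OddCharacter

variable {N : ℕ} [NeZero N] (f : CuspForm (Gamma0 N) 2)

omit [NeZero N] in
/-- The sign-conjugate `εγε = (a, −b; −c, d)` of `γ = (a, b; c, d) ∈ Γ₀(N)` lies in `Γ₀(N)` (Manin 1972 §1.6; same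
construction as `…ThetaLayerLambdaCongruenceAtTwo.exists_gamma0_signConj`). [cite: Manin1972, §1.6] -/
theorem exists_signConj (γ : Gamma0 N) :
    ∃ γ' : Gamma0 N, (γ' : SL(2, ℤ)) 0 0 = (γ : SL(2, ℤ)) 0 0 ∧ (γ' : SL(2, ℤ)) 1 0 = -((γ : SL(2, ℤ)) 1 0) := by
  have hdet :
      (γ : SL(2, ℤ)) 0 0 * (γ : SL(2, ℤ)) 1 1 - (γ : SL(2, ℤ)) 0 1 * (γ : SL(2, ℤ)) 1 0 = 1 := by
    have := Matrix.det_fin_two (γ : SL(2, ℤ)).1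
    rw [(γ : SL(2, ℤ)).2] at this
    linear_combination -this
  let M : SL(2, ℤ) := ⟨!![(γ : SL(2, ℤ)) 0 0, -((γ : SL(2, ℤ)) 0 1);
      -((γ : SL(2, ℤ)) 1 0), (γ : SL(2, ℤ)) 1 1], by
    rw [Matrix.det_fin_two_of]; linear_combination hdet⟩
  have hM : M ∈ Gamma0 N := by
    rw [Gamma0_mem]
    have hγ := Gamma0_mem.mp γ.2
    simp only [M, Matrix.of_apply, Matrix.cons_val', Matrix.cons_val_zero, Matrix.cons_val_one,
      Int.cast_neg, hγ, neg_zero]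
  exact ⟨⟨M, hM⟩, rfl, rfl⟩

/-- **(II) ⟹ an odd mod-2 eigencharacter.** Let `f` be a normalised newform of level `N` with rational coefficients and
Hecke eigenvalues `A p = a_p(f) ∈ ℤ`, and assume `Ω⁺_f/2 ∉ Λ_f` (half the real period is not a period: the period lattice is
rhombic). Then there is a map `χ₀ : Γ₀(N) → ZMod 2` that is additive, factors through the period functional, is a Hecke
eigencharacter with eigenvalues `A p mod 2` at all primes — and is NOT even under `γ ↦ εγε`. Construction: `Ω⁺_f =
{∞,γ₀∞} + {∞,εγ₀ε∞} ∈ Λ_f` is not a double in `Λ_f`, so some character `φ` of `Λ_f/2Λ_f` has `φ(Ω⁺_f) ≠ 0`; put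
`χ₀ γ = φ({∞,γ∞}_f)`; the eigen-property is `T_p f = a_p f`, and `χ₀(εγ₀ε) − χ₀(γ₀) = φ(Ω⁺_f) ≠ 0`.
[cite: CremonaAlgorithms1997, §2.8] [cite: Manin1972, §1.6] -/
theorem exists_eigenChar_not_even_of_half_plusPeriod_not_mem (hf : IsNewform0 f) (hQ : coeffField f = ⊥)
    (A : ℕ → ℤ) (hA : ∀ p : ℕ, p.Prime → cuspCoeff f p = (A p : ℂ))
    (hrh : ((plusPeriod f / 2 : ℝ) : ℂ) ∉ periodLattice f) :
    ∃ χ₀ : Gamma0 N → ZMod 2,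
      (∀ γ γ' : Gamma0 N, χ₀ (γ * γ') = χ₀ γ + χ₀ γ') ∧
      (∀ γ γ' : Gamma0 N, periodFunctional N γ = periodFunctional N γ' → χ₀ γ = χ₀ γ') ∧
      (∀ (p : ℕ) (hp : p.Prime) (γ σ : Gamma0 N),
        periodFunctional N σ = (haveI : NeZero p := ⟨hp.ne_zero⟩; heckeT (Gamma0 N) 2 p).dualMap (periodFunctional N γ) →
        χ₀ σ = ((A p : ℤ) : ZMod 2) * χ₀ γ) ∧
      ∃ γ γ' : Gamma0 N, (γ' : SL(2, ℤ)) 0 0 = (γ : SL(2, ℤ)) 0 0 ∧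
        (γ' : SL(2, ℤ)) 1 0 = -((γ : SL(2, ℤ)) 1 0) ∧ χ₀ γ' ≠ χ₀ γ := by
  have hreal : ∀ n, (cuspCoeff f n).im = 0 := cuspCoeff_im_eq_zero_of_coeffField_eq_bot hQ
  have hΩ : plusPeriod f ≠ 0 := (IsNewform0.plusPeriod_pos_holds hf hQ).ne'
  set L : AddSubgroup ℂ := periodLattice f with hL
  have hmem : ∀ γ : Gamma0 N, cuspSymbol f γ ∈ L := fun γ ↦ AddSubgroup.subset_closure ⟨γ, rfl⟩
  -- `Ω⁺ = z₀ + conj z₀ ∈ Λ_f`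
  obtain ⟨γ₀, hγ₀⟩ := exists_re_cuspSymbol_eq_plusPeriod_half f hΩ
  obtain ⟨γ₀', h00, h10⟩ := exists_signConj γ₀
  have hconj : cuspSymbol f γ₀' = starRingEnd ℂ (cuspSymbol f γ₀) := cuspSymbol_eq_conj_of_apply f hreal γ₀ γ₀' h00 h10
  have hsum : cuspSymbol f γ₀ + cuspSymbol f γ₀' = ((plusPeriod f : ℝ) : ℂ) := by
    rw [hconj, Complex.add_conj, hγ₀]
    push_cast; ring
  have hΩmem : ((plusPeriod f : ℝ) : ℂ) ∈ L := hsum ▸ add_mem (hmem γ₀) (hmem γ₀')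
  -- `Ω⁺` is not a double in `Λ_f`
  have hnd : ¬ ∃ y : L, 2 • y = ⟨((plusPeriod f : ℝ) : ℂ), hΩmem⟩ := by
    rintro ⟨y, hy⟩
    apply hrh
    have hy' : (2 : ℂ) * (y : ℂ) = ((plusPeriod f : ℝ) : ℂ) := by
      have := congrArg Subtype.val hy
      simpa [two_mul, two_smul] using this
    have : (y : ℂ) = ((plusPeriod f / 2 : ℝ) : ℂ) := by
      push_cast
      rw [← hy']; ring
    rw [hL, ← this]
    exact y.2
  obtain ⟨φ, hφ⟩ := exists_addMonoidHom_zmod_two_apply_ne_zero hnd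
  -- the character
  refine ⟨fun γ ↦ φ ⟨cuspSymbol f γ, hmem γ⟩, ?_, ?_, ?_, γ₀, γ₀', h00, h10, ?_⟩
  · intro γ γ'
    have hx : (⟨cuspSymbol f (γ * γ'), hmem (γ * γ')⟩ : L) = ⟨cuspSymbol f γ, hmem γ⟩ + ⟨cuspSymbol f γ', hmem γ'⟩ :=
      Subtype.ext (cuspSymbol_mul_holds f γ γ')
    simp only [hx, map_add]
  · intro γ γ' h
    have hx : cuspSymbol f γ = cuspSymbol f γ' := by
      rw [← periodFunctional_apply N γ f, ← periodFunctional_apply N γ' f, h]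
    simp only [hx]
  · intro p hp γ σ hσ
    haveI : NeZero p := ⟨hp.ne_zero⟩
    have hT : heckeT (Gamma0 N) 2 p f = ((A p : ℤ) : ℂ) • f := by
      rw [IsNewform0.heckeT_eq_coeff_smul hf hp]
      change cuspCoeff f p • f = _
      rw [hA p hp]
    have h1 : cuspSymbol f σ = ((A p : ℤ) : ℂ) * cuspSymbol f γ := by
      have := congrArg (fun ψ : Module.Dual ℂ (CuspForm (Gamma0 N) 2) ↦ ψ f) hσ
      simp only [periodFunctional_apply, LinearMap.dualMap_apply] at this
      rw [this, hT, cuspSymbol_smul]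
    have h2 : (⟨cuspSymbol f σ, hmem σ⟩ : L) = (A p : ℤ) • (⟨cuspSymbol f γ, hmem γ⟩ : L) :=
      Subtype.ext (by simp [h1])
    simp only [h2, map_zsmul, zsmul_eq_mul]
  · intro h
    have h' : φ ⟨cuspSymbol f γ₀', hmem γ₀'⟩ = φ ⟨cuspSymbol f γ₀, hmem γ₀⟩ := h
    apply hφ
    have h2 : (⟨((plusPeriod f : ℝ) : ℂ), hΩmem⟩ : L) = ⟨cuspSymbol f γ₀, hmem γ₀⟩ + ⟨cuspSymbol f γ₀', hmem γ₀'⟩ :=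
      Subtype.ext hsum.symm
    rw [h2, map_add, h']
    exact ZModModule.add_self _

/-- **Converse: (MO⁺) forces (II).** If `Ω⁺_f/2 ∈ Λ_f` (rectangular period lattice) then the two characters
`χ(γ) = φ({∞,γ∞}_f)`, `φ` ranging over the characters of `Λ_f/2Λ_f`, are ALL even (`φ(2 re z) = 2φ(Ω⁺_f/2 · k) = 0`), so
evenness cuts nothing: any character of `Λ_f/2Λ_f` non-zero on `Λ_f` and vanishing at a period with `re = Ω⁺_f/2` is a
non-zero even eigencharacter DIFFERENT from the doubled-real-period character `χ_f = (2re{∞,γ∞}_f/Ω⁺_f) mod 2` (which is `1`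
there). Stated contrapositively in the currency of `hMO`: (MO⁺) together with the existence of such a `φ` gives `Ω⁺_f/2 ∉ Λ_f`.
Recorded to show that (II) is exactly the complex-conjugation content of (MO⁺). [cite: CremonaAlgorithms1997, §2.8] -/
theorem half_plusPeriod_not_mem_of_multOnePlus (hf : IsNewform0 f) (hQ : coeffField f = ⊥)
    (A : ℕ → ℤ) (hA : ∀ p : ℕ, p.Prime → cuspCoeff f p = (A p : ℂ))
    (hMO : ∀ χ₁ χ₂ : Gamma0 N → ZMod 2,
      (∀ γ γ' : Gamma0 N, χ₁ (γ * γ') = χ₁ γ + χ₁ γ') →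
      (∀ γ γ' : Gamma0 N, periodFunctional N γ = periodFunctional N γ' → χ₁ γ = χ₁ γ') →
      (∀ γ γ' : Gamma0 N, (γ' : SL(2, ℤ)) 0 0 = (γ : SL(2, ℤ)) 0 0 →
        (γ' : SL(2, ℤ)) 1 0 = -((γ : SL(2, ℤ)) 1 0) → χ₁ γ' = χ₁ γ) →
      (∀ (p : ℕ) (hp : p.Prime) (γ σ : Gamma0 N),
        periodFunctional N σ = (haveI : NeZero p := ⟨hp.ne_zero⟩; heckeT (Gamma0 N) 2 p).dualMap (periodFunctional N γ) →
        χ₁ σ = ((A p : ℤ) : ZMod 2) * χ₁ γ) →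
      (∀ γ γ' : Gamma0 N, χ₂ (γ * γ') = χ₂ γ + χ₂ γ') →
      (∀ γ γ' : Gamma0 N, periodFunctional N γ = periodFunctional N γ' → χ₂ γ = χ₂ γ') →
      (∀ γ γ' : Gamma0 N, (γ' : SL(2, ℤ)) 0 0 = (γ : SL(2, ℤ)) 0 0 →
        (γ' : SL(2, ℤ)) 1 0 = -((γ : SL(2, ℤ)) 1 0) → χ₂ γ' = χ₂ γ) →
      (∀ (p : ℕ) (hp : p.Prime) (γ σ : Gamma0 N),
        periodFunctional N σ = (haveI : NeZero p := ⟨hp.ne_zero⟩; heckeT (Gamma0 N) 2 p).dualMap (periodFunctional N γ) →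
        χ₂ σ = ((A p : ℤ) : ZMod 2) * χ₂ γ) →
      (∃ γ, χ₁ γ ≠ 0) → (∃ γ, χ₂ γ ≠ 0) → ∀ γ, χ₁ γ = χ₂ γ)
    (φ : periodLattice f →+ ZMod 2) (γ₁ : Gamma0 N) (hφ₁ : φ ⟨cuspSymbol f γ₁, AddSubgroup.subset_closure ⟨γ₁, rfl⟩⟩ ≠ 0)
    (γ₀ : Gamma0 N) (hγ₀ : (cuspSymbol f γ₀).re = plusPeriod f / 2)
    (hφ₀ : φ ⟨cuspSymbol f γ₀, AddSubgroup.subset_closure ⟨γ₀, rfl⟩⟩ = 0) :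
    ((plusPeriod f / 2 : ℝ) : ℂ) ∉ periodLattice f := by
  intro hhalf
  have hreal : ∀ n, (cuspCoeff f n).im = 0 := cuspCoeff_im_eq_zero_of_coeffField_eq_bot hQ
  have hΩ : plusPeriod f ≠ 0 := (IsNewform0.plusPeriod_pos_holds hf hQ).ne'
  have hmem : ∀ γ : Gamma0 N, cuspSymbol f γ ∈ periodLattice f := fun γ ↦ AddSubgroup.subset_closure ⟨γ, rfl⟩
  choose mf hmf using exists_int_re_cuspSymbol_eq f hΩ
  -- χ_f, the doubled real period character: the four clauses, and `χ_f γ₀ = 1`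
  have hf_add : ∀ γ γ' : Gamma0 N, mf (γ * γ') = mf γ + mf γ' := by
    intro γ γ'
    apply int_eq_of_mul_plusPeriod_half_eq f hΩ
    have h := congrArg Complex.re (cuspSymbol_mul_holds f γ γ')
    rw [Complex.add_re, hmf, hmf, hmf] at h
    rw [h]; push_cast; ring
  have hf_per : ∀ γ γ' : Gamma0 N, periodFunctional N γ = periodFunctional N γ' → mf γ = mf γ' := by
    intro γ γ' h
    apply int_eq_of_mul_plusPeriod_half_eq f hΩ
    rw [← hmf, ← hmf, ← periodFunctional_apply N γ f, ← periodFunctional_apply N γ' f, h]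
  have hf_plus : ∀ γ γ' : Gamma0 N, (γ' : SL(2, ℤ)) 0 0 = (γ : SL(2, ℤ)) 0 0 →
      (γ' : SL(2, ℤ)) 1 0 = -((γ : SL(2, ℤ)) 1 0) → mf γ' = mf γ := by
    intro γ γ' h00 h10
    apply int_eq_of_mul_plusPeriod_half_eq f hΩ
    rw [← hmf, ← hmf, cuspSymbol_eq_conj_of_apply f hreal γ γ' h00 h10, Complex.conj_re]
  have hf_hecke : ∀ (p : ℕ) (hp : p.Prime) (γ σ : Gamma0 N),
      periodFunctional N σ = (haveI : NeZero p := ⟨hp.ne_zero⟩; heckeT (Gamma0 N) 2 p).dualMap (periodFunctional N γ) →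
      mf σ = A p * mf γ := by
    intro p hp γ σ hσ
    haveI : NeZero p := ⟨hp.ne_zero⟩
    have hT : heckeT (Gamma0 N) 2 p f = ((A p : ℤ) : ℂ) • f := by
      rw [IsNewform0.heckeT_eq_coeff_smul hf hp]
      change cuspCoeff f p • f = _
      rw [hA p hp]
    have h1 : cuspSymbol f σ = ((A p : ℤ) : ℂ) * cuspSymbol f γ := by
      have := congrArg (fun φ : Module.Dual ℂ (CuspForm (Gamma0 N) 2) ↦ φ f) hσ
      simp only [periodFunctional_apply, LinearMap.dualMap_apply] at this
      rw [this, hT, cuspSymbol_smul]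
    apply int_eq_of_mul_plusPeriod_half_eq f hΩ
    have := congrArg Complex.re h1
    rw [show (((A p : ℤ) : ℂ)) = (((A p : ℤ) : ℝ) : ℂ) by norm_cast, Complex.re_ofReal_mul, hmf, hmf] at this
    rw [this]; push_cast; ring
  have hmf0 : mf γ₀ = 1 := int_eq_of_mul_plusPeriod_half_eq f hΩ (by rw [← hmf, hγ₀]; push_cast; ring)
  -- χ_φ := φ ∘ {∞,·∞}_f : the three structural clauses
  set χ : Gamma0 N → ZMod 2 := fun γ ↦ φ ⟨cuspSymbol f γ, hmem γ⟩ with hχ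
  have hχ_add : ∀ γ γ' : Gamma0 N, χ (γ * γ') = χ γ + χ γ' := by
    intro γ γ'
    have hx : (⟨cuspSymbol f (γ * γ'), hmem (γ * γ')⟩ : periodLattice f) =
        ⟨cuspSymbol f γ, hmem γ⟩ + ⟨cuspSymbol f γ', hmem γ'⟩ :=
      Subtype.ext (cuspSymbol_mul_holds f γ γ')
    simp only [hχ, hx, map_add]
  have hχ_per : ∀ γ γ' : Gamma0 N, periodFunctional N γ = periodFunctional N γ' → χ γ = χ γ' := by
    intro γ γ' h
    have hx : cuspSymbol f γ = cuspSymbol f γ' := by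
      rw [← periodFunctional_apply N γ f, ← periodFunctional_apply N γ' f, h]
    simp only [hχ, hx]
  have hχ_hecke : ∀ (p : ℕ) (hp : p.Prime) (γ σ : Gamma0 N),
      periodFunctional N σ = (haveI : NeZero p := ⟨hp.ne_zero⟩; heckeT (Gamma0 N) 2 p).dualMap (periodFunctional N γ) →
      χ σ = ((A p : ℤ) : ZMod 2) * χ γ := by
    intro p hp γ σ hσ
    haveI : NeZero p := ⟨hp.ne_zero⟩
    have hT : heckeT (Gamma0 N) 2 p f = ((A p : ℤ) : ℂ) • f := by
      rw [IsNewform0.heckeT_eq_coeff_smul hf hp]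
      change cuspCoeff f p • f = _
      rw [hA p hp]
    have h1 : cuspSymbol f σ = ((A p : ℤ) : ℂ) * cuspSymbol f γ := by
      have := congrArg (fun ψ : Module.Dual ℂ (CuspForm (Gamma0 N) 2) ↦ ψ f) hσ
      simp only [periodFunctional_apply, LinearMap.dualMap_apply] at this
      rw [this, hT, cuspSymbol_smul]
    have h2 : (⟨cuspSymbol f σ, hmem σ⟩ : periodLattice f) = (A p : ℤ) • (⟨cuspSymbol f γ, hmem γ⟩ : periodLattice f) :=
      Subtype.ext (by simp [h1])
    simp only [hχ, h2, map_zsmul, zsmul_eq_mul]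
  -- χ_φ is EVEN because `Ω⁺_f/2 ∈ Λ_f`: `{∞,εγε∞} = {∞,γ∞}¯ = {∞,γ∞} − 2i im = {∞,γ∞} + (Ω⁺ m_γ) − 2{∞,γ∞}`
  have hχ_plus : ∀ γ γ' : Gamma0 N, (γ' : SL(2, ℤ)) 0 0 = (γ : SL(2, ℤ)) 0 0 →
      (γ' : SL(2, ℤ)) 1 0 = -((γ : SL(2, ℤ)) 1 0) → χ γ' = χ γ := by
    intro γ γ' h00 h10
    have hc : cuspSymbol f γ' = starRingEnd ℂ (cuspSymbol f γ) := cuspSymbol_eq_conj_of_apply f hreal γ γ' h00 h10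
    -- z' = (2 mf γ) • (Ω⁺/2) - z  with Ω⁺/2 ∈ Λ_f
    have hz : (⟨cuspSymbol f γ', hmem γ'⟩ : periodLattice f) =
        (2 * mf γ : ℤ) • (⟨((plusPeriod f / 2 : ℝ) : ℂ), hhalf⟩ : periodLattice f) - ⟨cuspSymbol f γ, hmem γ⟩ := by
      apply Subtype.ext
      simp only [AddSubgroupClass.coe_sub, AddSubgroupClass.coe_zsmul, zsmul_eq_mul]
      rw [hc]
      apply Complex.ext
      · simp only [Complex.conj_re, Complex.sub_re, Complex.mul_re, Complex.ofReal_re, Complex.ofReal_im,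
          mul_zero, sub_zero, hmf γ]
        push_cast
        simp only [Complex.intCast_re, Complex.mul_re, Complex.re_ofNat, Complex.im_ofNat, Complex.intCast_im,
          mul_zero, sub_zero]
        ring
      · simp only [Complex.conj_im, Complex.sub_im, Complex.mul_im, Complex.ofReal_re, Complex.ofReal_im,
          mul_zero, zero_add]
        push_cast
        simp only [Complex.intCast_im, Complex.mul_im, Complex.re_ofNat, Complex.im_ofNat, Complex.intCast_re,
          mul_zero, zero_mul, add_zero, zero_sub]
    simp only [hχ, hz, map_sub, map_zsmul]
    rw [mul_comm, ← smul_smul, two_zsmul, ZModModule.add_self, smul_zero, zero_sub, ZModModule.neg_eq_self]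
  -- (MO⁺) applied to χ_f and χ_φ: they coincide, but differ at γ₀
  have heq := hMO (fun γ ↦ (mf γ : ZMod 2)) χ
    (fun γ γ' ↦ by simp only [hf_add]; push_cast; rfl)
    (fun γ γ' h ↦ by simp only [hf_per γ γ' h])
    (fun γ γ' h00 h10 ↦ by simp only [hf_plus γ γ' h00 h10])
    (fun p hp γ σ h ↦ by simp only [hf_hecke p hp γ σ h]; push_cast; rfl)
    hχ_add hχ_per hχ_plus hχ_hecke ⟨γ₀, by rw [hmf0]; exact one_ne_zero⟩ ⟨γ₁, hφ₁⟩ γ₀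
  simp only [hmf0, Int.cast_one, hχ] at heq
  exact one_ne_zero (heq.trans hφ₀)

end OddCharacter

end MultOneDictionary

end Summit.BirchSwinnertonDyer.BirchSwinnertonDyer.Theorems.SignedMuAtTwo

end
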